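import Literature.Analysis.FluidPDE.TaoClassTranslation
import Literature.Analysis.FluidPDE.BackwardUniquenessSobolevClass
import Summits.NavierStokesRegularity.FluidComputer.PalasekTowerLiveClassAt
import HarnessLib

/-!
# Affine equivariance is decided by the datum, forwards AND backwards, in Tao's class (Negative lane, `HeredityAtOneT`)

A CLASS-EXCLUSION brick for the live-class censuses of the Palasek tower (LADDER-NS N1, items
20304 `HeredityAtOneT` / 20305 `HeredityFromTwoT` / 20303 `EpisodeBaseT`). For a rigid motion
`g : x ↦ A x + b` of `ℝ³` (`A` a linear isometry) write `g · w := conjSlice A b w = A⁻¹ ∘ w ∘ g`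
(`PalasekTowerLiveClassAt.conjSlice`); a field is `g`-EQUIVARIANT when `g · w = w`. For a Tao-class
run `IsTaoSolutionOn T ν u₀ u p` (`0 < T`, `0 < ν`):

* `conjSlice_eq_on_Icc_of_datum` — a `g`-equivariant datum gives `g`-equivariant slices at every
  `t ∈ [0, T]` (the placed run `t ↦ g · u t` is Tao-class from the same datum,
  `IsTaoSolutionOn.rigidPlacement`, so it coincides with `u`: Prodi–Serrin uniqueness `eq_on_Icc`);
* `conjSlice_eq_on_Icc_of_final` — a `g`-equivariant FINAL slice gives `g`-equivariant slices at
  every `t ∈ [0, T]`, in particular a `g`-equivariant datum (backward uniqueness in the Sobolev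
  class, `IsClassicalNSSolutionOn.backward_unique_of_sobolev`);
* `conjSlice_eq_iff_datum` — hence `g · u t = u t ↔ g · u₀ = u₀` for every `t ∈ [0, T]`, and
  `symmetryMotions_eq` — the SET of rigid motions fixing the slice is CONSTANT in time (stated
  as a set-builder equality; no new definition).

So every symmetry class cut out by rigid motions (axisymmetric about any axis, helical,
mirror-symmetric pairs, discrete rotation groups, …) is entered or left only at `t = 0`: a
stratum census by symmetry type of live/dead/sterile designs is a census of DATA. The dead
class of `PalasekTowerLiveClassAt` (placed axisymmetric swirl-free) is the special case treated in
`DeadSliceBackwardTaoClass`. Sources: covariance, Majda–Bertozzi 2002, §1.2 Prop. 1.1 and §2.3.3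
(2.52)–(2.53) ("the solution … will remain axisymmetric"); backward uniqueness, Temam 1997,
Ch. III §6.2, Lemma 6.2.

WHAT THIS IS NOT: not Navier–Stokes evidence; [folklore]-level symmetry bookkeeping on landed
uniqueness theorems; sorry-free, std axioms; no item moves.
-/

noncomputable section

open Set
open Literature.Analysis.FluidPDE
open Summit.NavierStokesRegularity.FluidComputer.PalasekTowerClayBridge

namespace Summit.NavierStokesRegularity.HeredityAtOneTAffineEquivariance

variable {T ν : ℝ} {u₀ : EuclideanSpace ℝ (Fin 3) → EuclideanSpace ℝ (Fin 3)}
  {u : ℝ → EuclideanSpace ℝ (Fin 3) → EuclideanSpace ℝ (Fin 3)}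
  {p : ℝ → EuclideanSpace ℝ (Fin 3) → ℝ}

/-- **Forward: an equivariant datum gives equivariant slices** (rigid motion `x ↦ A x + b`).
[cite: MajdaBertozziCUP2002, §2.3.3 (2.52)-(2.53)] -/
theorem conjSlice_eq_on_Icc_of_datum (hT : 0 < T) (hν : 0 < ν) (h : IsTaoSolutionOn T ν u₀ u p)
    (A : EuclideanSpace ℝ (Fin 3) ≃ₗᵢ[ℝ] EuclideanSpace ℝ (Fin 3)) (b : EuclideanSpace ℝ (Fin 3))
    (h0 : conjSlice A b u₀ = u₀) : ∀ t ∈ Icc 0 T, conjSlice A b (u t) = u t := by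
  have hv : IsTaoSolutionOn T ν (conjSlice A b u₀) (fun t => conjSlice A b (u t))
      (fun t x => p t (A x + b)) := h.rigidPlacement hT A b
  rw [h0] at hv
  exact IsTaoSolutionOn.eq_on_Icc hv h hν hT

/-- **Backward: an equivariant FINAL slice gives equivariant slices, hence an equivariant datum.**
[cite: Temam1997, Ch. III §6.2 Lemma 6.2 (pp. 172-175)] -/
theorem conjSlice_eq_on_Icc_of_final (hT : 0 < T) (hν : 0 < ν) (h : IsTaoSolutionOn T ν u₀ u p)
    (A : EuclideanSpace ℝ (Fin 3) ≃ₗᵢ[ℝ] EuclideanSpace ℝ (Fin 3)) (b : EuclideanSpace ℝ (Fin 3))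
    (hfin : conjSlice A b (u T) = u T) : ∀ t ∈ Icc 0 T, conjSlice A b (u t) = u t := by
  have hv : IsTaoSolutionOn T ν (conjSlice A b u₀) (fun t => conjSlice A b (u t))
      (fun t x => p t (A x + b)) := h.rigidPlacement hT A b
  exact IsClassicalNSSolutionOn.backward_unique_of_sobolev hT hν hv.classical h.classical hv.sobolev
    hv.sobolev_dt h.sobolev h.sobolev_dt hfin

/-- Backward, datum form. [cite: Temam1997, Ch. III §6.2 Lemma 6.2 (pp. 172-175)] -/
theorem conjSlice_datum_eq_of_final (hT : 0 < T) (hν : 0 < ν) (h : IsTaoSolutionOn T ν u₀ u p)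
    (A : EuclideanSpace ℝ (Fin 3) ≃ₗᵢ[ℝ] EuclideanSpace ℝ (Fin 3)) (b : EuclideanSpace ℝ (Fin 3))
    (hfin : conjSlice A b (u T) = u T) : conjSlice A b u₀ = u₀ := by
  rw [← h.initial]
  exact conjSlice_eq_on_Icc_of_final hT hν h A b hfin 0 ⟨le_rfl, hT.le⟩

/-- **Equivariance under a rigid motion is decided by the datum**: for every `t ∈ [0, T]`,
`conjSlice A b (u t) = u t ↔ conjSlice A b u₀ = u₀`. [folklore] -/
theorem conjSlice_eq_iff_datum (hν : 0 < ν) (h : IsTaoSolutionOn T ν u₀ u p)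
    (A : EuclideanSpace ℝ (Fin 3) ≃ₗᵢ[ℝ] EuclideanSpace ℝ (Fin 3)) (b : EuclideanSpace ℝ (Fin 3))
    {t₁ : ℝ} (ht₁ : t₁ ∈ Icc 0 T) : conjSlice A b (u t₁) = u t₁ ↔ conjSlice A b u₀ = u₀ := by
  rcases eq_or_lt_of_le ht₁.1 with h0 | h0
  · rw [← h0, h.initial]
  · have h' : IsTaoSolutionOn t₁ ν u₀ u p := h.mono h0 ht₁.2
    exact ⟨conjSlice_datum_eq_of_final h0 hν h' A b,
      fun hd => conjSlice_eq_on_Icc_of_datum h0 hν h' A b hd t₁ ⟨h0.le, le_rfl⟩⟩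

/-- **The symmetry motions of the slices of a Tao-class run are CONSTANT IN TIME** on `[0, T]`:
the set of rigid motions `(A, b)` with `conjSlice A b (u t) = u t` equals the set fixing `u₀`.
Every stratum of a census by rigid symmetry type is entered or left only through the datum.
[folklore] -/
theorem symmetryMotions_eq (hν : 0 < ν) (h : IsTaoSolutionOn T ν u₀ u p) {t₁ : ℝ}
    (ht₁ : t₁ ∈ Icc 0 T) :
    {g : (EuclideanSpace ℝ (Fin 3) ≃ₗᵢ[ℝ] EuclideanSpace ℝ (Fin 3)) × EuclideanSpace ℝ (Fin 3) |
        conjSlice g.1 g.2 (u t₁) = u t₁} =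
      {g | conjSlice g.1 g.2 u₀ = u₀} :=
  Set.ext fun g => conjSlice_eq_iff_datum hν h g.1 g.2 ht₁

/-- In particular two slices of one Tao-class run have the same symmetry motions. [folklore] -/
theorem symmetryMotions_eq_of_mem (hν : 0 < ν) (h : IsTaoSolutionOn T ν u₀ u p) {t₁ t₂ : ℝ}
    (ht₁ : t₁ ∈ Icc 0 T) (ht₂ : t₂ ∈ Icc 0 T) :
    {g : (EuclideanSpace ℝ (Fin 3) ≃ₗᵢ[ℝ] EuclideanSpace ℝ (Fin 3)) × EuclideanSpace ℝ (Fin 3) |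
        conjSlice g.1 g.2 (u t₁) = u t₁} =
      {g | conjSlice g.1 g.2 (u t₂) = u t₂} := by
  rw [symmetryMotions_eq hν h ht₁, symmetryMotions_eq hν h ht₂]

end Summit.NavierStokesRegularity.HeredityAtOneTAffineEquivariance

end
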